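import Literature.Geometry.Riemannian.HamiltonTraceSharpAlgebra
import HarnessLib

/-!
# Hamilton 1986, Lemma 6.2 at a maximiser: `tr A' + tr C' - 2 tr (B'T) ≥ p₁ (a - 2b + c)`
(topic `Geometry/Riemannian`)

A step of the decomposition of the named fact
`Literature.Geometry.Riemannian.hamilton_positiveCurvatureOperator_classification_four`
(`HamiltonPCOClassification.lean`; Hamilton 1986, Thm. 1.1), towards Thm. 7.1. Hamilton 1986,
§6, **Lemma 6.2** (J. Differential Geom. 24 (1986), pp. 168–170):

> `d/dt (a - 2b + c) ≥ (a₁ + 2b₁ + c₁)(a - 2b + c)`,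

where `a = tr A = c = tr C` and `b = b₁ + b₂ + b₃ = sup {tr BT}`, "the sup taken over all
orthogonal transformations `T : Λ²₊ → Λ²₋`" (p. 168), along the ODE `M' = M² + M^#` in block form
(`HamiltonODE.field`: `A' = A² + BᵗB + 2A^#`, `B' = AB + BC + 2B^#`, `C' = C² + ᵗBB + 2C^#`).
By Danskin's formula (Lemma 3.5) the derivative of `-2b` is bounded below by `-2 tr (B'T)` at a
maximiser `T`; the content of the lemma is therefore the **pointwise inequality at a maximiser**,
which this file PROVES (`HamiltonODE.lemma62_pointwise`):

if `A`, `C` are symmetric with `tr A = tr C` (Bianchi), `M = (A B; ᵗB C) ≥ 0`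
(`HamiltonODE.OperatorGE · 0`), `T` is orthogonal and maximises `T' ↦ tr (BT')` over the
orthogonal group, and `p₁` bounds the symmetric matrix `P = A + 2BT + ᵗT C T` from below
(`ᵗu P u ≥ p₁ |u|²`; Hamilton: "`p₁ ≥ a₁ + 2b₁ + c₁`"), then
`tr A' + tr C' - 2 tr (B'T) ≥ p₁ (tr A - 2 tr (BT) + tr C)`.

Ingredients, all proved: at a maximiser `D = BT` is symmetric and `≥ 0`
(`isSymm_of_isMaxTrace`, `quad_nonneg_of_isMaxTrace`: compare with `T` composed with plane
rotations and with reflections — this is Hamilton's "choose coordinates in which `B` is diagonal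
with entries `b₁ ≤ b₂ ≤ b₃`", p. 168); in the coordinates `Λ²₋ ≅ Λ²₊` given by `T`
(`C_T = ᵗT C T`) the quantity is
`tr (A - D)² + tr (C_T - D)² + 2 tr (A^# - 2 det T · D^# + C_T^#)`; for `det T = 1` this is
Hamilton's expression (p. 169) and for `det T = -1` it is larger by `8 tr D^# ≥ 0`; then the
algebra of `HamiltonTraceSharpAlgebra.lean` (`2(A^# - 2D^# + C_T^#) = (A - C_T)^# + (P # Q)`,
`tr (A - C_T)^# = -½ tr (A - C_T)²`, the parallelogram law, and `tr P # Q ≥ p₁ tr Q` for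
`Q = A - 2D + C_T ≥ 0`, which holds because `ᵗu Q u = M((u, -Tu), (u, -Tu))`).

Also: `O(3)` is compact (`isCompact_orthogonalSet`) and maximisers of `tr (BT)` exist
(`exists_isMaxTrace`). No definitions and no named facts are introduced.

## References

* R. S. Hamilton, *Four-manifolds with positive curvature operator*, J. Differential Geom. 24
  (1986) 153–179, §6, Lemma 6.2 and its proof (pp. 168–170); §3, Lemma 3.5 (p. 159).
  [Hamilton1986]
-/

noncomputable section

open Matrix
open scoped Matrix BigOperators

namespace Literature.Geometry.Riemannian

namespace HamiltonODE

/-! ### Orthogonal `3 × 3` matrices: adjoints and determinants -/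

/-- A left-orthogonal square matrix is right-orthogonal. [folklore] -/
theorem mul_transpose_self_of_orthogonal {T : Matrix (Fin 3) (Fin 3) ℝ} (hT : Tᵀ * T = 1) :
    T * Tᵀ = 1 :=
  mul_eq_one_comm.1 hT

/-- `(det T)² = 1` for orthogonal `T`. [folklore] -/
theorem det_sq_of_orthogonal {T : Matrix (Fin 3) (Fin 3) ℝ} (hT : Tᵀ * T = 1) : T.det ^ 2 = 1 := by
  have h := congrArg Matrix.det hT
  rwa [Matrix.det_mul, Matrix.det_transpose, Matrix.det_one, ← sq] at h

/-- `det T ≤ 1` for orthogonal `T`. [folklore] -/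
theorem det_le_one_of_orthogonal {T : Matrix (Fin 3) (Fin 3) ℝ} (hT : Tᵀ * T = 1) : T.det ≤ 1 := by
  nlinarith [det_sq_of_orthogonal hT]

/-- For orthogonal `T`, `adj (ᵗT) = det T · T`. [folklore] -/
theorem adjugate_transpose_of_orthogonal {T : Matrix (Fin 3) (Fin 3) ℝ} (hT : Tᵀ * T = 1) :
    Tᵀ.adjugate = T.det • T := by
  have h := Matrix.adjugate_mul Tᵀ
  have h2 := congrArg (· * T) h
  simp only [Matrix.mul_assoc, hT, Matrix.mul_one, Matrix.smul_mul, Matrix.one_mul,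
    Matrix.det_transpose] at h2
  exact h2

/-- `(XY)^# = X^# Y^#` (`adj (XY) = adj Y · adj X`, transposed). [folklore] -/
theorem sharp_mul (X Y : Matrix (Fin 3) (Fin 3) ℝ) : (X * Y).sharp = X.sharp * Y.sharp := by
  simp only [Matrix.sharp, Matrix.adjugate_mul_distrib, Matrix.transpose_mul]

/-- For orthogonal `T` and any `D`: `(D ᵗT)^# T = det T · D^#`. [folklore] -/
theorem sharp_mul_transpose_mul_of_orthogonal {T : Matrix (Fin 3) (Fin 3) ℝ} (hT : Tᵀ * T = 1)
    (D : Matrix (Fin 3) (Fin 3) ℝ) : (D * Tᵀ).sharp * T = T.det • D.sharp := by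
  rw [sharp_mul]
  simp only [Matrix.sharp]
  rw [adjugate_transpose_of_orthogonal hT, Matrix.transpose_smul, Matrix.mul_smul,
    Matrix.smul_mul, Matrix.mul_assoc, hT, Matrix.mul_one]

/-! ### Structure of a maximiser of `T ↦ tr (BT)` over the orthogonal group -/

/-- The trace of `S` against a rank-one matrix is the quadratic form. [folklore] -/
theorem trace_mul_vecMulVec (S : Matrix (Fin 3) (Fin 3) ℝ) (v : Fin 3 → ℝ) :
    (S * Matrix.vecMulVec v v).trace = v ⬝ᵥ (S *ᵥ v) := by
  simp only [Matrix.trace_fin_three, Matrix.mul_apply, Matrix.vecMulVec_apply, dotProduct,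
    Matrix.mulVec, Fin.sum_univ_three]
  ring

/-- `(v ᵗv)(v ᵗv) = |v|² v ᵗv`. [folklore] -/
theorem vecMulVec_mul_self (v : Fin 3 → ℝ) :
    Matrix.vecMulVec v v * Matrix.vecMulVec v v = (v ⬝ᵥ v) • Matrix.vecMulVec v v := by
  ext i j
  simp only [Matrix.mul_apply, Matrix.vecMulVec_apply, Matrix.smul_apply, dotProduct,
    Fin.sum_univ_three, smul_eq_mul]
  ring

/-- **The reflection `R_v = 1 - (2/|v|²) v ᵗv` is orthogonal** (`v ≠ 0`). [folklore] -/
theorem reflection_orthogonal {v : Fin 3 → ℝ} (hv : v ⬝ᵥ v ≠ 0) :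
    ((1 : Matrix (Fin 3) (Fin 3) ℝ) - (2 / (v ⬝ᵥ v)) • Matrix.vecMulVec v v)ᵀ *
        ((1 : Matrix (Fin 3) (Fin 3) ℝ) - (2 / (v ⬝ᵥ v)) • Matrix.vecMulVec v v) = 1 := by
  have hsymm : (Matrix.vecMulVec v v)ᵀ = Matrix.vecMulVec v v := by
    ext i j; simp [Matrix.vecMulVec_apply, mul_comm]
  rw [Matrix.transpose_sub, Matrix.transpose_one, Matrix.transpose_smul, hsymm, Matrix.sub_mul,
    Matrix.one_mul, Matrix.mul_sub, Matrix.mul_one, Matrix.smul_mul, Matrix.mul_smul,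
    vecMulVec_mul_self, smul_smul, smul_smul]
  have e' : 2 / (v ⬝ᵥ v) * (2 / (v ⬝ᵥ v)) * (v ⬝ᵥ v) = 2 / (v ⬝ᵥ v) + 2 / (v ⬝ᵥ v) := by
    field_simp; ring
  rw [e', add_smul]
  abel

/-- **At a maximiser of `tr (BT)` over the orthogonal group, `D = BT` has nonnegative quadratic
form** (compare with `T R_v`: `tr (B T R_v) = tr D - (2/|v|²) ᵗv D v`). (Hamilton 1986, p. 168:
at the supremum `B` is diagonal with `0 ≤ b₁ ≤ b₂ ≤ b₃`.) [cite: Hamilton1986, §6, p. 168] -/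
theorem quad_nonneg_of_isMaxTrace {B T : Matrix (Fin 3) (Fin 3) ℝ}
    (hmax : ∀ T' : Matrix (Fin 3) (Fin 3) ℝ, T'ᵀ * T' = 1 → (B * T').trace ≤ (B * T).trace)
    (hT : Tᵀ * T = 1) (v : Fin 3 → ℝ) : 0 ≤ v ⬝ᵥ ((B * T) *ᵥ v) := by
  by_cases hv : v ⬝ᵥ v = 0
  · rw [dotProduct_self_eq_zero.1 hv]; simp
  have hvpos : 0 < v ⬝ᵥ v :=
    lt_of_le_of_ne (Finset.sum_nonneg fun i _ ↦ mul_self_nonneg _) (Ne.symm hv)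
  set R : Matrix (Fin 3) (Fin 3) ℝ := 1 - (2 / (v ⬝ᵥ v)) • Matrix.vecMulVec v v with hR
  have hRo : Rᵀ * R = 1 := reflection_orthogonal hv
  have hTR : (T * R)ᵀ * (T * R) = 1 := by
    rw [Matrix.transpose_mul, Matrix.mul_assoc, ← Matrix.mul_assoc Tᵀ, hT, Matrix.one_mul, hRo]
  have h := hmax (T * R) hTR
  rw [← Matrix.mul_assoc, hR, Matrix.mul_sub, Matrix.mul_one, Matrix.mul_smul, Matrix.trace_sub,
    Matrix.trace_smul, trace_mul_vecMulVec, smul_eq_mul] at h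
  have h2 : 0 ≤ 2 / (v ⬝ᵥ v) * (v ⬝ᵥ ((B * T) *ᵥ v)) := by linarith
  have h3 : 0 < 2 / (v ⬝ᵥ v) := by positivity
  exact (mul_nonneg_iff_of_pos_left h3).1 h2

/-- If `c α + s β ≤ α` for all `(c, s)` on the unit circle then `β = 0`. [folklore] -/
theorem eq_zero_of_forall_circle_le {α β : ℝ}
    (h : ∀ c s : ℝ, c ^ 2 + s ^ 2 = 1 → c * α + s * β ≤ α) : β = 0 := by
  by_contra hβ
  set ρ := Real.sqrt (α ^ 2 + β ^ 2) with hρ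
  have hρpos : 0 < ρ := Real.sqrt_pos.2 (by positivity)
  have hρ2 : ρ ^ 2 = α ^ 2 + β ^ 2 := Real.sq_sqrt (by positivity)
  have h1 := h (α / ρ) (β / ρ) (by
    rw [div_pow, div_pow, ← add_div, ← hρ2, div_self (pow_ne_zero 2 hρpos.ne')])
  rw [div_mul_eq_mul_div, div_mul_eq_mul_div, ← add_div, ← sq, ← sq, ← hρ2,
    div_le_iff₀ hρpos, sq] at h1
  have hαρ : ρ ≤ α := le_of_mul_le_mul_left (by linarith) hρpos
  have : β ^ 2 ≤ 0 := by nlinarith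
  exact hβ (by nlinarith)

/-- The plane rotation in coordinates `(i, j) = (0, 1)`. [folklore] -/
theorem rot01_orthogonal {c s : ℝ} (h : c ^ 2 + s ^ 2 = 1) :
    (!![c, -s, 0; s, c, 0; 0, 0, 1] : Matrix (Fin 3) (Fin 3) ℝ)ᵀ *
      !![c, -s, 0; s, c, 0; 0, 0, 1] = 1 := by
  ext i j
  fin_cases i <;> fin_cases j <;>
    simp [Matrix.mul_apply, Fin.sum_univ_three] <;> nlinarith [h]

/-- The plane rotation in coordinates `(0, 2)`. [folklore] -/
theorem rot02_orthogonal {c s : ℝ} (h : c ^ 2 + s ^ 2 = 1) :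
    (!![c, 0, -s; 0, 1, 0; s, 0, c] : Matrix (Fin 3) (Fin 3) ℝ)ᵀ *
      !![c, 0, -s; 0, 1, 0; s, 0, c] = 1 := by
  ext i j
  fin_cases i <;> fin_cases j <;>
    simp [Matrix.mul_apply, Fin.sum_univ_three] <;> nlinarith [h]

/-- The plane rotation in coordinates `(1, 2)`. [folklore] -/
theorem rot12_orthogonal {c s : ℝ} (h : c ^ 2 + s ^ 2 = 1) :
    (!![1, 0, 0; 0, c, -s; 0, s, c] : Matrix (Fin 3) (Fin 3) ℝ)ᵀ *
      !![1, 0, 0; 0, c, -s; 0, s, c] = 1 := by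
  ext i j
  fin_cases i <;> fin_cases j <;>
    simp [Matrix.mul_apply, Fin.sum_univ_three] <;> nlinarith [h]

/-- **At a maximiser of `tr (BT)` over the orthogonal group, `D = BT` is symmetric** (compare
with `T` composed with plane rotations:
`tr (D R(θ)) = (D_ii + D_jj) cos θ + (D_ij - D_ji) sin θ + …` is maximal at `θ = 0`).
[cite: Hamilton1986, §6, p. 168] -/
theorem isSymm_of_isMaxTrace {B T : Matrix (Fin 3) (Fin 3) ℝ}
    (hmax : ∀ T' : Matrix (Fin 3) (Fin 3) ℝ, T'ᵀ * T' = 1 → (B * T').trace ≤ (B * T).trace)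
    (hT : Tᵀ * T = 1) : (B * T).IsSymm := by
  set D := B * T with hD
  have key : ∀ R : Matrix (Fin 3) (Fin 3) ℝ, Rᵀ * R = 1 → (D * R).trace ≤ D.trace := by
    intro R hR
    have hTR : (T * R)ᵀ * (T * R) = 1 := by
      rw [Matrix.transpose_mul, Matrix.mul_assoc, ← Matrix.mul_assoc Tᵀ, hT, Matrix.one_mul, hR]
    have h := hmax (T * R) hTR
    rwa [← Matrix.mul_assoc] at h
  have h01 : D 0 1 - D 1 0 = 0 := by
    refine eq_zero_of_forall_circle_le (α := D 0 0 + D 1 1) fun c s hcs ↦ ?_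
    have h := key _ (rot01_orthogonal hcs)
    simp [Matrix.trace_fin_three, Matrix.mul_apply, Fin.sum_univ_three] at h
    linarith
  have h02 : D 0 2 - D 2 0 = 0 := by
    refine eq_zero_of_forall_circle_le (α := D 0 0 + D 2 2) fun c s hcs ↦ ?_
    have h := key _ (rot02_orthogonal hcs)
    simp [Matrix.trace_fin_three, Matrix.mul_apply, Fin.sum_univ_three] at h
    linarith
  have h12 : D 1 2 - D 2 1 = 0 := by
    refine eq_zero_of_forall_circle_le (α := D 1 1 + D 2 2) fun c s hcs ↦ ?_
    have h := key _ (rot12_orthogonal hcs)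
    simp [Matrix.trace_fin_three, Matrix.mul_apply, Fin.sum_univ_three] at h
    linarith
  refine Matrix.IsSymm.ext fun i j ↦ ?_
  fin_cases i <;> fin_cases j <;> simp <;> linarith

/-! ### Lemma 6.2 at a maximiser -/

/-- `tr (ᵗT C T)^# = tr C^#` for orthogonal `T` (both are `½((tr C)² - tr C²)`). [folklore] -/
theorem trace_sharp_conj_of_orthogonal {T : Matrix (Fin 3) (Fin 3) ℝ} (hT : Tᵀ * T = 1)
    (C : Matrix (Fin 3) (Fin 3) ℝ) : (Tᵀ * C * T).sharp.trace = C.sharp.trace := by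
  have hTT := mul_transpose_self_of_orthogonal hT
  have h1 := trace_mul_self_add_two_trace_sharp (Tᵀ * C * T)
  have h2 := trace_mul_self_add_two_trace_sharp C
  have htr : (Tᵀ * C * T).trace = C.trace := by
    rw [Matrix.trace_mul_cycle, hTT, Matrix.one_mul]
  have hsq : (Tᵀ * C * T * (Tᵀ * C * T)).trace = (C * C).trace := by
    rw [show Tᵀ * C * T * (Tᵀ * C * T) = Tᵀ * (C * C) * T by
      simp only [Matrix.mul_assoc]; rw [← Matrix.mul_assoc T Tᵀ, hTT, Matrix.one_mul]]
    rw [Matrix.trace_mul_cycle, hTT, Matrix.one_mul]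
  rw [htr, hsq] at h1
  linarith

/-- `ᵗu (A - 2BT + ᵗT C T) u = M((u, -Tu), (u, -Tu))`: the block quadratic form on the
antidiagonal of the identification `T` ("`A - 2B + C ≥ 0` by applying `M` to `(x, -x)`",
Hamilton 1986, p. 169). [cite: Hamilton1986, §6, Lemma 6.2 (proof, p. 169)] -/
theorem quad_antidiag_conj (A B C T : Matrix (Fin 3) (Fin 3) ℝ) (u : Fin 3 → ℝ) :
    u ⬝ᵥ ((A - (2 : ℝ) • (B * T) + Tᵀ * C * T) *ᵥ u) = quad (A, B, C) (u, -(T *ᵥ u)) := by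
  simp only [quad, Matrix.add_mulVec, Matrix.sub_mulVec, Matrix.smul_mulVec, dotProduct_add,
    dotProduct_sub, dotProduct_smul, smul_eq_mul, Matrix.mulVec_neg, dotProduct_neg,
    neg_dotProduct, neg_neg, ← Matrix.mulVec_mulVec, Matrix.dotProduct_transpose_mulVec]
  rw [dotProduct_comm (C *ᵥ (T *ᵥ u))]
  ring

/-- **Hamilton 1986, Lemma 6.2, at a maximiser.** Let `A`, `C` be symmetric `3 × 3` matrices with
`tr A = tr C`, `B` arbitrary, with `M = (A B; ᵗB C) ≥ 0` (`OperatorGE · 0`); let `T` be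
orthogonal and maximise `T' ↦ tr (BT')` over the orthogonal group (so `tr (BT) = b`, the sum of
the singular values of `B`), and let `p₁` satisfy `ᵗu (A + 2BT + ᵗT C T) u ≥ p₁ |u|²` for all `u`.
Then, for Hamilton's field `A' = A² + BᵗB + 2A^#`, `B' = AB + BC + 2B^#`, `C' = C² + ᵗBB + 2C^#`
(`HamiltonODE.field`),
`tr A' + tr C' - 2 tr (B'T) ≥ p₁ · (tr A - 2 tr (BT) + tr C)`
— the right-hand side of "`d/dt (a - 2b + c) ≥ (a₁ + 2b₁ + c₁)(a - 2b + c)`" once the left-hand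
side is identified with the derivative by Danskin's formula (Lemma 3.5).
[cite: Hamilton1986, §6, Lemma 6.2 (pp. 168–170)] -/
theorem lemma62_pointwise {A B C T : Matrix (Fin 3) (Fin 3) ℝ} (hA : A.IsSymm) (hC : C.IsSymm)
    (htr : A.trace = C.trace) (hM : OperatorGE (A, B, C) 0) (hT : Tᵀ * T = 1)
    (hmax : ∀ T' : Matrix (Fin 3) (Fin 3) ℝ, T'ᵀ * T' = 1 → (B * T').trace ≤ (B * T).trace)
    {p₁ : ℝ} (hP : ∀ u : Fin 3 → ℝ,
      p₁ * (u ⬝ᵥ u) ≤ u ⬝ᵥ ((A + (2 : ℝ) • (B * T) + Tᵀ * C * T) *ᵥ u)) :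
    p₁ * (A.trace - 2 * (B * T).trace + C.trace) ≤
      (field (A, B, C)).1.trace + (field (A, B, C)).2.2.trace -
        2 * ((field (A, B, C)).2.1 * T).trace := by
  -- notation and the structure of the maximiser
  have hTT := mul_transpose_self_of_orthogonal hT
  set D := B * T with hD
  set CT := Tᵀ * C * T with hCT
  have hDs : D.IsSymm := isSymm_of_isMaxTrace hmax hT
  have hD0 : ∀ u : Fin 3 → ℝ, 0 ≤ u ⬝ᵥ (D *ᵥ u) := quad_nonneg_of_isMaxTrace hmax hT
  have hB : B = D * Tᵀ := by rw [hD, Matrix.mul_assoc, hTT, Matrix.mul_one]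
  have hCTs : CT.IsSymm := by
    change (Tᵀ * C * T)ᵀ = Tᵀ * C * T
    rw [Matrix.transpose_mul, Matrix.transpose_mul, Matrix.transpose_transpose, hC.eq,
      Matrix.mul_assoc]
  -- the trace bookkeeping in the coordinates given by `T`
  have e_trCT : CT.trace = C.trace := by
    rw [hCT, Matrix.trace_mul_cycle, hTT, Matrix.one_mul]
  have e_CC : (C * C).trace = (CT * CT).trace := by
    rw [hCT, show Tᵀ * C * T * (Tᵀ * C * T) = Tᵀ * (C * C) * T by
      simp only [Matrix.mul_assoc]; rw [← Matrix.mul_assoc T Tᵀ, hTT, Matrix.one_mul]]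
    rw [Matrix.trace_mul_cycle, hTT, Matrix.one_mul]
  have e_Csharp : C.sharp.trace = CT.sharp.trace := (trace_sharp_conj_of_orthogonal hT C).symm
  have e_BBt : (B * Bᵀ).trace = (D * D).trace := by
    rw [hB, Matrix.transpose_mul, Matrix.transpose_transpose, hDs.eq,
      show D * Tᵀ * (T * D) = D * (Tᵀ * T) * D by simp only [Matrix.mul_assoc], hT,
      Matrix.mul_one]
  have e_BtB : (Bᵀ * B).trace = (D * D).trace := by rw [Matrix.trace_mul_comm, e_BBt]
  have e_ABT : (A * B * T).trace = (A * D).trace := by rw [Matrix.mul_assoc, ← hD]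
  have e_BCT : (B * C * T).trace = (D * CT).trace := by
    rw [hB, hCT, show D * Tᵀ * C * T = D * (Tᵀ * C * T) by simp only [Matrix.mul_assoc]]
  have e_BsT : (B.sharp * T).trace = T.det * D.sharp.trace := by
    rw [hB, sharp_mul_transpose_mul_of_orthogonal hT, Matrix.trace_smul, smul_eq_mul]
  -- expand the field
  have eΦ : (field (A, B, C)).1.trace + (field (A, B, C)).2.2.trace -
      2 * ((field (A, B, C)).2.1 * T).trace =
      ((A * A).trace + (D * D).trace + 2 * A.sharp.trace) +
        ((CT * CT).trace + (D * D).trace + 2 * CT.sharp.trace) -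
        2 * ((A * D).trace + (D * CT).trace + 2 * (T.det * D.sharp.trace)) := by
    simp only [field, Matrix.add_mul, Matrix.smul_mul, Matrix.trace_add, Matrix.trace_smul,
      smul_eq_mul, e_CC, e_Csharp, e_BBt, e_BtB, e_ABT, e_BCT, e_BsT]
  -- regroup: `tr(A-D)² + tr(CT-D)² + 2 tr(A^# - 2D^# + CT^#) + 4(1 - det T) tr D^#`
  have e_sq1 : ((A - D) * (A - D)).trace = (A * A).trace - 2 * (A * D).trace + (D * D).trace := by
    have := Matrix.trace_mul_comm A D
    simp only [Matrix.sub_mul, Matrix.mul_sub, Matrix.trace_sub]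
    linarith
  have e_sq2 : ((CT - D) * (CT - D)).trace =
      (CT * CT).trace - 2 * (D * CT).trace + (D * D).trace := by
    have := Matrix.trace_mul_comm CT D
    simp only [Matrix.sub_mul, Matrix.mul_sub, Matrix.trace_sub]
    linarith
  -- the algebra of `HamiltonTraceSharpAlgebra.lean`
  set P := A + (2 : ℝ) • D + CT with hPdef
  set Q := A - (2 : ℝ) • D + CT with hQdef
  have e_comb := congrArg Matrix.trace (four_smul_sharp_combination A D CT)
  simp only [Matrix.trace_smul, Matrix.trace_add, Matrix.trace_sub, smul_eq_mul] at e_comb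
  rw [← hPdef, ← hQdef] at e_comb
  have htr0 : (A - CT).trace = 0 := by rw [Matrix.trace_sub, e_trCT, htr, sub_self]
  have e_zero := trace_sharp_of_trace_eq_zero htr0
  have e_par := parallelogram_trace A D CT
  rw [← hQdef] at e_par
  -- positivity inputs
  have hQs : Q.IsSymm := (hA.sub ((hDs.smul (2 : ℝ)))).add hCTs
  have hQ0 : ∀ u : Fin 3 → ℝ, 0 ≤ u ⬝ᵥ (Q *ᵥ u) := fun u ↦ by
    rw [hQdef, hCT, hD, quad_antidiag_conj]
    exact hM.nonneg le_rfl _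
  have hQsq : 0 ≤ (Q * Q).trace := trace_mul_self_nonneg_of_isSymm hQs
  have hPQ : 2 * p₁ * Q.trace ≤ (polarSharp P Q).trace :=
    trace_polarSharp_ge (fun u ↦ by rw [hPdef, hCT, hD]; exact hP u) hQs hQ0
  have hDsharp : 0 ≤ D.sharp.trace := by
    have h := trace_polarSharp_ge (P := D) (Q := D) (p₁ := 0)
      (fun u ↦ by rw [zero_mul]; exact hD0 u) hDs hD0
    rw [polarSharp_self, Matrix.trace_smul, smul_eq_mul] at h
    linarith
  have hdet : T.det ≤ 1 := det_le_one_of_orthogonal hT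
  have hQtr : Q.trace = A.trace - 2 * (B * T).trace + C.trace := by
    rw [hQdef, Matrix.trace_add, Matrix.trace_sub, Matrix.trace_smul, smul_eq_mul, e_trCT, ← hD]
  -- assemble
  rw [eΦ, ← hQtr]
  have hineq : 0 ≤ D.sharp.trace - T.det * D.sharp.trace := by
    have := mul_nonneg (show 0 ≤ 1 - T.det by linarith) hDsharp
    nlinarith
  have hPQ' : p₁ * Q.trace ≤ (1 / 2) * (polarSharp P Q).trace := by linarith
  linarith [e_comb, e_zero, e_par, hQsq, hPQ', hineq, e_sq1, e_sq2]

/-! ### The orthogonal group is compact: maximisers exist -/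

/-- The set of orthogonal `3 × 3` matrices is closed. [folklore] -/
theorem isClosed_orthogonalSet : IsClosed {T : Matrix (Fin 3) (Fin 3) ℝ | Tᵀ * T = 1} :=
  isClosed_eq (continuous_id.matrix_transpose.matrix_mul continuous_id) continuous_const

/-- The entries of an orthogonal matrix lie in `[-1, 1]` (its columns are unit vectors).
[folklore] -/
theorem entry_mem_Icc_of_orthogonal {T : Matrix (Fin 3) (Fin 3) ℝ} (hT : Tᵀ * T = 1)
    (i j : Fin 3) : T i j ∈ Set.Icc (-1 : ℝ) 1 := by
  have h := congr_fun (congr_fun hT j) j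
  simp only [Matrix.mul_apply, Matrix.transpose_apply, Matrix.one_apply_eq] at h
  have hle : T i j * T i j ≤ ∑ k, T k j * T k j :=
    Finset.single_le_sum (f := fun k ↦ T k j * T k j) (fun k _ ↦ mul_self_nonneg (T k j))
      (Finset.mem_univ i)
  rw [h] at hle
  constructor <;> nlinarith [hle, sq_nonneg (T i j - 1), sq_nonneg (T i j + 1)]

/-- **The orthogonal group `O(3)` is compact** (closed and contained in the box `[-1, 1]^{3×3}`).
[folklore] -/
theorem isCompact_orthogonalSet : IsCompact {T : Matrix (Fin 3) (Fin 3) ℝ | Tᵀ * T = 1} := by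
  have hbox : IsCompact
      (Set.univ.pi fun _ : Fin 3 ↦ Set.univ.pi fun _ : Fin 3 ↦ Set.Icc (-1 : ℝ) 1) :=
    isCompact_univ_pi fun _ ↦ isCompact_univ_pi fun _ ↦ isCompact_Icc
  refine hbox.of_isClosed_subset isClosed_orthogonalSet fun T hT ↦ ?_
  simp only [Set.mem_univ_pi]
  exact fun i j ↦ entry_mem_Icc_of_orthogonal hT i j

/-- `O(3)` is nonempty. [folklore] -/
theorem orthogonalSet_nonempty : ({T : Matrix (Fin 3) (Fin 3) ℝ | Tᵀ * T = 1}).Nonempty :=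
  ⟨1, by simp⟩

/-- `T ↦ tr (BT)` is continuous. [folklore] -/
theorem continuous_trace_mul (B : Matrix (Fin 3) (Fin 3) ℝ) :
    Continuous fun T : Matrix (Fin 3) (Fin 3) ℝ ↦ (B * T).trace := by
  simp only [Matrix.trace_fin_three]
  have h : Continuous fun T : Matrix (Fin 3) (Fin 3) ℝ ↦ B * T :=
    continuous_const.matrix_mul continuous_id
  exact ((h.matrix_elem 0 0).add (h.matrix_elem 1 1)).add (h.matrix_elem 2 2)

/-- **Maximisers of `tr (BT)` over `O(3)` exist** (Hamilton 1986, p. 167: "the inf or sup is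
attained"): so `b = b₁ + b₂ + b₃ = max_{T ∈ O(3)} tr (BT)` and `lemma62_pointwise` applies at a
maximiser. [cite: Hamilton1986, §6, pp. 167–168] -/
theorem exists_isMaxTrace (B : Matrix (Fin 3) (Fin 3) ℝ) :
    ∃ T : Matrix (Fin 3) (Fin 3) ℝ, Tᵀ * T = 1 ∧
      ∀ T' : Matrix (Fin 3) (Fin 3) ℝ, T'ᵀ * T' = 1 → (B * T').trace ≤ (B * T).trace := by
  obtain ⟨T, hT, hmax⟩ :=
    isCompact_orthogonalSet.exists_isMaxOn orthogonalSet_nonempty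
      (continuous_trace_mul B).continuousOn
  exact ⟨T, hT, fun T' hT' ↦ hmax hT'⟩

end HamiltonODE

end Literature.Geometry.Riemannian

end
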